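import Summits.NavierStokesRegularity.NavierStokesRegularity.Theorems.CoriolisHeadCounterRotatingLiouvilleHeadIdentity
import Literature.Analysis.FluidPDE.CurlFreeLiouville

/-!
# Route CoriolisHead · crux `CounterRotatingLiouville` (stmt-NavierStokesRegularity-22677) —
# stub 4 `stub_endgame`: constant rotating head + signed Coriolis defect ⇒ constant profile

Support file of the line `tsai-rotating-head-chain` (theorems only; `--supports
stmt-NavierStokesRegularity-22677`).  If the rotating head pressure
`Π_B = ½|U|² + P + a⟨y,U⟩ − ⟨By,U⟩` of a smooth bounded rotated Leray profile is constant, then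
`νΔΠ_B − W·∇Π_B = 0`, so by the exact identity (`stub_rotatingHeadIdentity`)
`½ν Σ (∂ₗUᵢ − ∂ᵢUₗ)² + 2ν Σₗ (B ∂ₗU)ₗ = 0`; both terms being `≥ 0` (the second by the sign
hypothesis `tr(B∘DU) ≥ 0`), the Jacobian is symmetric, `curl U = 0`; with `div U = 0` and `U`
bounded, `U` is constant (`eq_of_curl_eq_zero_of_isDivFree_of_bounded`, KNSS 2009 Lemma 3.1).
This is Tsai's endgame (1998, p. 48) with the Coriolis defect added.  NS regularity is NOT
proved here.
-/

noncomputable section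

-- the summit and its single sub-problem share the name (CONVENTIONS §1), as in every Theorems file
set_option linter.dupNamespace false

open MeasureTheory Set Function Filter Topology InnerProductSpace Metric
open scoped RealInnerProductSpace Laplacian ContDiff BigOperators
open Literature.Analysis.FluidPDE

namespace Summit.NavierStokesRegularity.NavierStokesRegularity.Theorems.CoriolisHead

/-- A field on `ℝ³` whose Jacobian is symmetric in the standard coordinates at `y` has
`curl U y = 0`. -/
theorem curl_eq_zero_of_symm {U : EuclideanSpace ℝ (Fin 3) → EuclideanSpace ℝ (Fin 3)}
    {y : EuclideanSpace ℝ (Fin 3)}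
    (h : ∀ l i : Fin 3, fderiv ℝ U y (EuclideanSpace.single l 1) i =
      fderiv ℝ U y (EuclideanSpace.single i 1) l) : curl U y = 0 := by
  have h12 := h 1 2
  have h20 := h 2 0
  have h01 := h 0 1
  simp only [curl]
  ext k
  fin_cases k <;> simp [h12, h20, h01]

/-- The drift operator annihilates constants: `driftOp ν a V (fun _ => c) y = 0`. -/
theorem driftOp_const {ν a : ℝ} (V : EuclideanSpace ℝ (Fin 3) → EuclideanSpace ℝ (Fin 3)) (c : ℝ)
    (y : EuclideanSpace ℝ (Fin 3)) : driftOp ν a V (fun _ => c) y = 0 := by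
  rw [driftOp, laplacian_const_eq_zero, fderiv_fun_const]
  simp

/-- **Registered stub `stub_endgame`** of the skeleton of crux `CounterRotatingLiouville` (line
`tsai-rotating-head-chain`): a smooth bounded rotated Leray profile with signed Coriolis defect
`Σₗ (B ∂ₗU)ₗ ≥ 0` and CONSTANT rotating head pressure is constant (identity ⇒ symmetric Jacobian
⇒ `curl U = 0`; `div U = 0`, bounded ⇒ constant). -/
theorem stub_endgame : ∀ (ν a : ℝ), 0 < ν → 0 < a → ∀ (B : EuclideanSpace ℝ (Fin 3) →L[ℝ] EuclideanSpace ℝ (Fin 3)) (U : EuclideanSpace ℝ (Fin 3) → EuclideanSpace ℝ (Fin 3)) (P : EuclideanSpace ℝ (Fin 3) → ℝ), ContDiff ℝ (⊤ : ℕ∞) U → ContDiff ℝ 2 P → (∀ x, inner ℝ (B x) x = 0) → Literature.Analysis.FluidPDE.VectorCalculus.IsDivFree U → (∀ y, -(ν • Laplacian.laplacian U y) + a • U y + a • fderiv ℝ U y y + (B (U y) - fderiv ℝ U y (B y)) + Literature.Analysis.FluidPDE.convect U U y + gradient P y = 0) → (∃ M : ℝ, ∀ y, ‖U y‖ ≤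 M) → (∀ y, 0 ≤ ∑ l, (B (fderiv ℝ U y (EuclideanSpace.single l 1))) l) → (∀ x y, (fun z => Literature.Analysis.FluidPDE.headPressure a U P z - inner ℝ (B z) (U z)) x = (fun z => Literature.Analysis.FluidPDE.headPressure a U P z - inner ℝ (B z) (U z)) y) → ∃ b : EuclideanSpace ℝ (Fin 3), ∀ y, U y = b := by
  intro ν a hν ha B U P hU hP hB hdiv heq hbdd hsign hconst
  have hU2 : ContDiff ℝ 2 U := hU.of_le (by norm_cast)
  have hUd : Differentiable ℝ U := hU.differentiable (by simp)
  obtain ⟨M, hM⟩ := hbdd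
  -- the rotating head is constant, so the drift operator kills it
  have hΘ : (fun z => headPressure a U P z - ⟪B z, U z⟫) =
      fun _ => headPressure a U P 0 - ⟪B 0, U 0⟫ := funext fun x => hconst x 0
  have hdrift : ∀ y, driftOp ν a (fun z => U z - B z)
      (fun z => headPressure a U P z - ⟪B z, U z⟫) y = 0 := fun y => by
    rw [hΘ]; exact driftOp_const _ _ _
  -- the identity: sum of squares + signed defect = 0
  have hsq : ∀ y, ∑ l, ∑ i, (pderiv l (fun z => U z i) y - pderiv i (fun z => U z l) y) ^ 2 = 0 := by
    intro y
    have h := stub_rotatingHeadIdentity ν a B U P hU hP hB hdiv heq y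
    rw [hdrift y] at h
    have h1 : 0 ≤ ∑ l, ∑ i, (pderiv l (fun z => U z i) y - pderiv i (fun z => U z l) y) ^ 2 :=
      Finset.sum_nonneg fun l _ => Finset.sum_nonneg fun i _ => sq_nonneg _
    have h2 := hsign y
    nlinarith
  -- hence the Jacobian is symmetric and `curl U = 0`
  have hsymm : ∀ y (l i : Fin 3), fderiv ℝ U y (EuclideanSpace.single l 1) i =
      fderiv ℝ U y (EuclideanSpace.single i 1) l := by
    intro y l i
    have hl := (Finset.sum_eq_zero_iff_of_nonneg fun l _ =>
      Finset.sum_nonneg fun i _ => sq_nonneg _).1 (hsq y) l (Finset.mem_univ _)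
    have hli := (Finset.sum_eq_zero_iff_of_nonneg fun i _ => sq_nonneg _).1 hl i (Finset.mem_univ _)
    have : pderiv l (fun z => U z i) y = pderiv i (fun z => U z l) y := by
      have := pow_eq_zero_iff (n := 2) (by norm_num) |>.1 hli
      linarith
    rw [pderiv_apply, pderiv_apply, ← euclidean_fderiv_apply_comp (hUd y),
      ← euclidean_fderiv_apply_comp (hUd y)] at this
    exact this
  have hcurl : ∀ y, curl U y = 0 := fun y => curl_eq_zero_of_symm (hsymm y)
  exact ⟨U 0, fun y => eq_of_curl_eq_zero_of_isDivFree_of_bounded hU2 hcurl hdiv hM y 0⟩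

end Summit.NavierStokesRegularity.NavierStokesRegularity.Theorems.CoriolisHead

end
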